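import Summits.ABC.Analytic.Requirements
import Summits.ABC.Analytic.PolySzpiro
import Summits.ABC.Statement
import Literature.NumberTheory.EllipticCurves.PastenSpectralDegreeProofs
import Literature.NumberTheory.EllipticCurves.DegreeConjectureAbcSemistable
import Literature.NumberTheory.EllipticCurves.SilvermanHeightCovolumeProofs
import Literature.NumberTheory.DiophantineGeometry.PastenValuationProductsProofs
import HarnessLib
import HarnessLib.Audit

/-!
# ABC — analytic / modular lens: the typed REQUIREMENTS TABLE for polynomial Szpiro over `ℚ` (II)

Cell `abc-an` (C1), seat `typ-1`; companion of `Summits/ABC/Analytic/Requirements.lean` (file I: rows R1/R5, A-PS skeletons S1/S2, floors) and of the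
sub-summit Prop `Summit.ABC.PolySzpiroRat` (`Summits/ABC/Analytic/PolySzpiro.lean`). HONESTY: abc is not proved by any of this; **A-PS** is **NOT abc —
«NOT abc — POLY-SZPIRO(E)»** (D-0139/D-0140); «NOT abc; first polynomial bound would supersede Stewart–Yu's exponential». Typed ≠ proved: every
`@[conjecture] def` is an OPEN statement used only as a hypothesis; KNOWN inputs not yet proved in the tree enter BY NAME as hypotheses (named facts). WHERE
LOST, two layers (TABLE R9, refereed): layer 1 = the COUNT of congruence partners (`≈ N/12` classes × `log N` each, MP 2013 Prop 3.4 / Thm 3.5, Pasten 2024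
Prop 7.1); layer 2 = Pasten's class product `∏ η` (Thm 5.5) is itself super-polynomial infinitely often (quadratic-twist / 2-torsion Eisenstein partners), so
a polynomial closing hypothesis must bound the `f`-ISOTYPIC denominator (`n'_f`, R9), not the product.

## Rows here
* **R4 congruence number** `r_f = #S₂(ℤ)/(ℤf + (ℤf)^⊥)` (`congruenceNumber`, Agashe–Ribet–Stein): GAP rows `PolyCongruenceNumberRat(Eff) K` = Murty's
  `log n_f ≪ log N` (Murty 1999; Murty–Pasten 2013 p. 3748) with explicit exponent; sharp row `SharpCongruenceNumberRat` (`r_f ≪_ε N^{2+ε}`, square-free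
  level). KNOWN links (NAMED FACTS): `m_f ∣ r_f` (Ribet, `modularDegree_dvd_congruenceNumber`), `deg_min(E) ≤ 163 · m_f`
  (`PastenShimura2024_minimalDegree_le_163_mul`), modularity (`nonempty_modularParametrizationData`); `r_f > 0` PROVED here. Best printed
  `log r_f ≤ (1/5) N log N` (MP Thm 4.3).
* **R9 Murty–Pasten's `n'_f`** (`anemicCongruenceNumber f = #𝕋'/(𝕀_f + Ann 𝕀_f)`, `𝕋' = anemicHeckeRing N 2`): GAP row `MurtyPastenConj44 K C` = MP 2013 Conj.
  4.4 `log n'_f ≪ log N` made uniform; `m_f ∣ n_f ∣ n'_f ∣ i_N` (MP p. 3748); WHERE LOST in print: `log i_N ≤ (1/5) N log N` counts the ≈ `N/12` congruence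
  partners (MP Thm 3.5; Pasten 2024 Thm 5.5 `δ ∣ ∏_{[χ]≠[χ₀]} η_{[χ₀]}([χ])`) — the COUNT, not the depth, kills polynomiality.
* **Converse inputs** (ONLY for height ⇒ degree / abc ⇒ degree conjecture): `PolyManinRat μ` (R6), `PeterssonUpperRat θ`.

## Skeletons (sorry-free)
S3 `polyModularDegreeRat_of_polyCongruenceNumberRat` (R4 ⇒ R1 mod modularity/Ribet/Mazur–Kenku, constant `× 163`); S3′
`polyModularDegreeRat_of_murtyPastenConj44` (R9 ⇒ R1, MP Thm 4.5 in kernel form, mod `m_f ∣ n'_f`); converse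
`polyModularDegreeRat_of_polyFaltingsHeightRat_of_manin_of_petersson` (R5 ∧ R6 ∧ R2-upper ⇒ R1 with exponent `2K + 2μ + 1 + θ`: with file I's R1 ⇒ R5 the
kernel form of "degree conjecture ⇔ height conjecture", Frey 1989 / Mai–Murty 1994, loss factors explicit); A0: `abc_of_degreeConjectureRat :
murty_petersson_newform_lower_bound → DegreeConjectureRat → ABC`, `szpiro_of_degreeConjectureRat`, `abc_of_sharpCongruenceNumberRat` (Murty 1999 Thm 1 (i)
through the tree's `abcLe_of_semistableDegreeBound`; abc-EQUIVALENT restatements, labelled so); floor ¬R4 (`K < 3/2`); §6 the conclusions BY NAME: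
`PolyModularDegreeRat K → Summit.ABC.PolySzpiroRat`, `PolyFaltingsHeightRat K → Summit.ABC.PolySzpiroRat` (+ `Eff` forms, the sharp `6K − 3 + ε`, R4/R9 ⇒
A-PS), `not_polySzpiroRatEff_of_le_six`, `polySzpiroRat_iff_rpow`. References: [AgasheRibetStein2012]; [MurtyCongruencePrimes1999]; [MurtyPasten2013] §4;
[PastenShimura2024] §3, Thm 5.5; [Frey1989]; [MaiMurty1994]; [HoffsteinLockhart1994]; [Cesnavicius2018]; [Masser1990]. -/

noncomputable section
namespace Summit.ABC.Analytic
open Literature.NumberTheory.EllipticCurves Literature.NumberTheory.EllipticCurves.ModularForms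
open CongruenceSubgroup WeierstrassCurve
open scoped MatrixGroups ModularForm

/-! ## §1 GAP rows R4, R9 and the converse inputs -/
/-- **R4 (GAP), effective form `(K, C)`: polynomial congruence number** — for every elliptic `W/ℚ` and every datum `D` at level `N` (so `D.f` is THE newform
of `W`), `r_f = congruenceNumber D.f ≤ C · N ^ K` (`#S₂(ℤ)/(ℤf + (ℤf)^⊥)`, the convention of `MurtyPasten.log_congruenceNumber_le`). This is Murty's
conjecture `log n_f ≪ log N` (Murty 1999; quoted in Murty–Pasten 2013 p. 3748) with the exponent explicit. OPEN (FALSE for `K < 3/2` mod the known links, §5);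
best printed `log n_f ≤ (1/5) N log N` (MP 2013 Thm 4.3, tree `MurtyPasten.log_congruenceNumber_le`). STRONGER than R1: R4 ⇒ R1 mod Ribet + Mazur–Kenku +
modularity (S3). «NOT abc — POLY-SZPIRO(E = 6K − 3 + ε)» (D-0139/D-0140). CALIBRATION (computed ≠ proved — a FLOOR on the admissible explicit `(K, C)`, never
evidence): DIRECT census = ENG-MSYM kit j288293+j289421 (exact `r_f` on 1,910 classes, levels `N ≤ 3476`; engine = Sage `congruence_number` on 327/327): in
range `C = 1 ⇒ K ≥ 1.938` (1290h1, `r_f = m_f = 1,068,480`); ARS Conj. 2.2 `ord_p(r_f/m_f) ≤ ½ ord_p N` holds on all 2,346 tested classes (0 violations, 58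
sharp), max `log(r_f/m_f)/log N = 0.448` (800f1). DERIVED floor (binding), modulo Ribet's `m_f ∣ r_f` (`modularDegree_dvd_congruenceNumber`) and the
ENG-MODDEG census (kit job j285537; all 3,064,705 curves `N < 500000` of Cremona's `ecdata`): `log r_f / log N ≥ log m_f / log N = 2.17755` at level
`N = 279366 = 2·3·101·461` (279366b1, `m_f = 723333273600`), so `C = 1 ⇒ K ≥ 2.1776` and `C = e⁵ ⇒ K ≥ 1.7788`; at square-free level `r_f = m_f` (ARS 2012 Thm
2.1 (b), tree fact `padicValNat_congruenceNumber_eq_of_not_sq_dvd`), so on the 786,065 semistable curves the `r_f`-floor IS the `m_f`-floor; for `p² ∣ N` the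
excess only raises it. `K < 3/2` is refuted for every `C` mod the known links (§5). [cite: MurtyPasten2013, §4 p. 3748] [cite: MurtyCongruencePrimes1999] -/
@[conjecture] def PolyCongruenceNumberRatEff (K C : ℝ) : Prop :=
  ∀ (W : WeierstrassCurve ℚ) [W.IsElliptic] (N : ℕ) [NeZero N] (D : ModularParametrizationData W N),
    (congruenceNumber D.f : ℝ) ≤ C * (N : ℝ) ^ K

/-- **R4 (GAP): polynomial congruence number with exponent `K`** — `∃ C, PolyCongruenceNumberRatEff K C` (Murty's `log n_f ≪ log N`). OPEN. «NOT abc —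
POLY-SZPIRO(E = 6K − 3 + ε)» (D-0139/D-0140). CALIBRATION (computed ≠ proved; table under `PolyCongruenceNumberRatEff`): direct census ENG-MSYM
j288293+j289421 (`N ≤ 3476`): `K ≥ 1.938` at `C = 1` (1290h1); derived via `m_f ∣ r_f` + ENG-MODDEG j285537 (binding): `K ≥ 2.1776` at `C = 1` (level 279366)
— a floor on witnesses, silent on truth. [cite: MurtyPasten2013, §4 p. 3748] [cite: MurtyCongruencePrimes1999] -/
@[conjecture] def PolyCongruenceNumberRat (K : ℝ) : Prop :=
  ∃ C : ℝ, PolyCongruenceNumberRatEff K C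

/-- **R4♯ (A0-strength row): the SHARP congruence-number conjecture at square-free level** — for every `ε > 0` there is `C` with `r_f ≤ C · N^{2+ε}` for the
newform of every elliptic `W/ℚ` at square-free level `N` (for `p² ∣ N` extra primes may divide `r_f/m_f`, ARS 2012 Thm 2.1 / Conj. 2.2). Implies
`SemistableDegreeConjecture` and, with the Petersson `1−ε` fact, `ABC` (`abc_of_sharpCongruenceNumberRat`): abc-EQUIVALENT strength — a RESTATEMENT, labelled
so. CALIBRATION (computed ≠ proved): at square-free level `r_f = m_f` (ARS 2012 Thm 2.1 (b)), so the ENG-MODDEG census (kit job j285537, `N < 500000`)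
calibrates this row modulo that theorem: `C(ε) ≥ m_f / N^{2+ε}` at the square-free level `N = 279366` (279366b1, `log m_f / log N = 2.17755`, the in-range
maximum) forces `C(0) ≥ 9.268`, `C(0.1) ≥ 2.645`, `C(0.2) ≥ 0.7547`, still rising in range — `C(ε)` is load-bearing, as for `DegreeConjectureRat`. ENG-MSYM
j288293+j289421 (`N ≤ 3476`): ARS Conj. 2.2 holds on 2,346 classes, 0 violations. [cite: AgasheRibetStein2012, Thm. 2.1] -/
@[conjecture] def SharpCongruenceNumberRat : Prop :=
  ∀ ε : ℝ, 0 < ε → ∃ C : ℝ, ∀ (W : WeierstrassCurve ℚ) [W.IsElliptic] (N : ℕ) [NeZero N]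
    (D : ModularParametrizationData W N), Squarefree N → (congruenceNumber D.f : ℝ) ≤ C * (N : ℝ) ^ (2 + ε)

/-- **Murty–Pasten's `n'_f`** (MP 2013 p. 3748: the denominator of the projector `p_f` with respect to the coprime Hecke algebra `𝕋'_N`; `n_f ∣ n'_f ∣ i_N`):
the order of the congruence module `𝕋' ⧸ (𝕀_f + Ann 𝕀_f)` for `𝕋' = anemicHeckeRing N 2`, `𝕀_f = eigenIdeal f` (tree's `congruenceModulus`; junk `0` if
infinite). [cite: MurtyPasten2013, §4 p. 3748 (definition of n'_f)] -/
def anemicCongruenceNumber {N : ℕ} [NeZero N] (f : CuspForm (Gamma0 N) 2) : ℕ :=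
  congruenceModulus (eigenIdeal f) (Submodule.annihilator (eigenIdeal f))

/-- **R9 (GAP): Murty–Pasten 2013, Conjecture 4.4, made uniform with exponent `(K, C)`** — for the newform of every elliptic curve at every level: `n'_f` is
finite and `log n'_f ≤ K log N + C` (printed: "The quantity `n'_f` satisfies `log n'_f ≪ log N`"; Thm 4.5: it "implies Frey's modular degree conjecture,
hence, the Height conjecture, the Szpiro conjecture and a version of the ABC conjecture"; unconditionally `log n'_f ≪ N log N`). OPEN. «NOT abc —
POLY-SZPIRO(E = 6K − 3 + ε)» (D-0139/D-0140). CALIBRATION (computed ≠ proved): DIRECT census ENG-MSYM kit j288293+j289421 (pre-registered against THIS decl;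
2,388 classes, levels `≤ 3476`, 1,950 certified values; PARI engine PENDING): certified FALSE: `C = 0 ∧ K < 1.938` (1290h1, `n'_f = 1,068,480`),
`K = 1 ∧ C < 6.719`, `K = 2 ∧ C < −0.443`; the `n'_f` envelope IS the `m_f` envelope (certified excess `≤ 0.551 log N`, a `{2,3}`-number): no super-polynomial
signal. DERIVED floor (binding), modulo `m_f ∣ n_f ∣ n'_f` (MP 2013 p. 3748) and ENG-MODDEG j285537 (`N < 500000`): `log n'_f ≥ log m_f = 27.31` at level
`N = 279366` (279366b1), so `C = 0 ⇒ K ≥ 2.1776` and `C = 5 ⇒ K ≥ 1.7788`. [cite: MurtyPasten2013, Conj. 4.4 and Thm. 4.5 (p. 3748)] -/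
@[conjecture] def MurtyPastenConj44 (K C : ℝ) : Prop :=
  ∀ (W : WeierstrassCurve ℚ) [W.IsElliptic] (N : ℕ) [NeZero N] (D : ModularParametrizationData W N),
    0 < anemicCongruenceNumber D.f ∧ Real.log (anemicCongruenceNumber D.f : ℝ) ≤ K * Real.log N + C

/-- **R6-converse input: polynomial Manin constant** — some `M` such that every globally minimal elliptic `W/ℚ` that has a datum at level `N_W` has one with
`|c| ≤ M · N_W ^ μ`. Enters ONLY the converse height ⇒ degree (Pasten 2024 Rem. 3.3: the Manin constant is the gap in "abc ⇒ degree conjecture"); NOT needed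
for A-PS. Status: `c = ±1` for semistable optimal curves (Česnavičius 2018; tree fact `abs_maninConstant_eq_one_of_isSemistable`), `c ∣ 6 · deg φ` (tree fact
`cesnaviciusNeururerSaha_thm_1_2`) — KNOWN once R1 holds, OPEN stand-alone for general `E`. CALIBRATION (database ≠ proved): Cremona's `ecdata` records
`c = 1` for the `X₀(N)`-optimal curve of EVERY class of conductor `N < 500000` (`manin.txt` / `opt_man`; tree named datum
`cremona_abs_maninConstant_eq_one_of_level_lt_500000`; optimal curve undetermined in 64,249 classes above `400000`), so `(μ, M) = (0, 1)` is uncontradicted in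
range for optimal `W`, and (derived, composing with a cyclic isogeny of degree `≤ 163`, Mazur–Kenku) `(0, 163)` for every `W`; no range statistic bears on
`μ > 0`. [cite: PastenShimura2024, Rem. 3.3] [cite: Cesnavicius2018, Thm. 1.2] -/
@[conjecture] def PolyManinRat (μ : ℝ) : Prop :=
  ∃ M : ℝ, ∀ (W : WeierstrassCurve ℚ) [W.IsElliptic] [W.IsGloballyMinimal] [NeZero (W.conductorNorm ℤ)],
    Nonempty (ModularParametrizationData W (W.conductorNorm ℤ)) →
      ∃ D : ModularParametrizationData W (W.conductorNorm ℤ),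
        |(D.maninConstant : ℝ)| ≤ M * (W.conductorNorm ℤ : ℝ) ^ μ

/-- **R2-upper input: `(f,f) ≤ C · N^{1+θ}`** for the newform of every elliptic `W/ℚ`. KNOWN in print for every `θ > 0` (Rankin–Selberg +
`L(1, Sym² f) ≪ log³ N`; square-free `N` PROVED in the tree, `Literature.NumberTheory.Automorphic.exists_petersson_le_mul_log_pow_of_squarefree`); general
level not yet typed — a formal debt, not a gap. Enters ONLY the converse height ⇒ degree. CALIBRATION: none needed — a theorem in print for every `θ > 0` (no
free exponent; square-free level PROVED in the tree); listed for completeness of REDUCTION CENSUS §R R2. [cite: MurtyCongruencePrimes1999, §2] -/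
@[conjecture] def PeterssonUpperRat (θ : ℝ) : Prop :=
  ∃ C : ℝ, ∀ (N : ℕ) [NeZero N] (W : WeierstrassCurve ℚ) [W.IsElliptic] (f : CuspForm (Gamma0 N) 2),
    IsNewformOf W f → (peterssonProduct (Gamma0 N) 2 f f).re ≤ C * (N : ℝ) ^ (1 + θ)

/-! ## §2 Known links (proved here from tree theorems) -/

section Links
variable {N : ℕ} [NeZero N] {W : WeierstrassCurve ℚ}
/-- **`r_f > 0` for the newform of a datum** (the congruence module is finite): from the tree's PROVED
`r_f ∣ ∏_{P ≠ 𝕀_f} η_f(P)` (Pasten 2024 §5.6) and `∏ η > 0`. [cite: PastenShimura2024, §5.6 p. 19] -/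
theorem congruenceNumber_pos_of_datum (D : ModularParametrizationData W N) : 0 < congruenceNumber D.f :=
  Nat.pos_of_dvd_of_pos D.congruenceNumber_dvd_prod_heckeCongruenceModulus D.prod_heckeCongruenceModulus_pos

/-- **A bound for optimal degrees gives R1** (modularity + Mazur–Kenku): if every datum of minimal degree in its
newform class has `deg ≤ B · N^K`, every globally minimal `W` has a datum of degree `≤ 163 B · N_W^K`. [cite: Kenku1982] -/
theorem polyModularDegreeRatEff_of_optimal_bound {K B : ℝ} (hmod : nonempty_modularParametrizationData)
    (h163 : PastenShimura2024_minimalDegree_le_163_mul)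
    (h : ∀ (W₀ : WeierstrassCurve ℚ) [W₀.IsElliptic] (N : ℕ) [NeZero N] (D₀ : ModularParametrizationData W₀ N),
      (∀ (W' : WeierstrassCurve ℚ) [W'.IsElliptic] (D' : ModularParametrizationData W' N),
          D'.f = D₀.f → D₀.modularDegree ≤ D'.modularDegree) →
        (D₀.modularDegree : ℝ) ≤ B * (N : ℝ) ^ K) :
    PolyModularDegreeRatEff K (163 * B) := by
  intro W _ _ _
  obtain ⟨DW, -, hDW⟩ := exists_minimal_datum (hmod W)
  obtain ⟨W₀, _, D₀, hf, hopt⟩ := Pasten2024.exists_minimal_datum_in_class DW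
  have h163' : DW.modularDegree ≤ 163 * D₀.modularDegree := h163 _ W₀ W D₀ DW hf.symm hopt hDW
  have h1 : (DW.modularDegree : ℝ) ≤ 163 * (D₀.modularDegree : ℝ) := by exact_mod_cast h163'
  have h2 : (D₀.modularDegree : ℝ) ≤ B * ((W.conductorNorm ℤ : ℕ) : ℝ) ^ K := h W₀ _ D₀ hopt
  exact ⟨DW, by linarith⟩

end Links
/-! ## §3 S3: R4 ⇒ R1 · S3′: R9 ⇒ R1 · converse R5 ∧ Manin ∧ Petersson-upper ⇒ R1 -/

/-- **S3: polynomial congruence number ⇒ polynomial modular degree** (same exponent, constant `× 163`), modulo the KNOWN facts modularity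
(`nonempty_modularParametrizationData`), Ribet's `m_f ∣ r_f` (`modularDegree_dvd_congruenceNumber`, ARS 2012 Thm 2.1), Mazur–Kenku
(`PastenShimura2024_minimalDegree_le_163_mul`); `r_f > 0` is PROVED. NOT abc. [cite: AgasheRibetStein2012, Thm. 2.1] [cite: PastenShimura2024, §3 p. 13] -/
theorem polyModularDegreeRat_of_polyCongruenceNumberRat {K : ℝ} (hmod : nonempty_modularParametrizationData)
    (hR : modularDegree_dvd_congruenceNumber) (h163 : PastenShimura2024_minimalDegree_le_163_mul)
    (h : PolyCongruenceNumberRat K) : PolyModularDegreeRat K := by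
  obtain ⟨C, hC⟩ := h
  refine ⟨163 * C, polyModularDegreeRatEff_of_optimal_bound hmod h163 fun W₀ _ N _ D₀ hopt => ?_⟩
  have hle : D₀.modularDegree ≤ congruenceNumber D₀.f :=
    Nat.le_of_dvd (congruenceNumber_pos_of_datum D₀) (hR W₀ N D₀ hopt)
  have hle' : (D₀.modularDegree : ℝ) ≤ (congruenceNumber D₀.f : ℝ) := by exact_mod_cast hle
  exact hle'.trans (hC W₀ N D₀)

/-- **S3′: Murty–Pasten Conj. 4.4 ⇒ polynomial modular degree** (constant `163 · e^C`), modulo modularity, Mazur–Kenku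
and the printed divisibility `m_f ∣ n'_f` (MP 2013 p. 3748: `m_f ∣ n_f ∣ n'_f`; KNOWN, not in the tree — the unfolded
hypothesis `hd`). MP Thm 4.5 in kernel form. [cite: MurtyPasten2013, Thm. 4.5 (p. 3748)] -/
theorem polyModularDegreeRat_of_murtyPastenConj44 {K C : ℝ} (hmod : nonempty_modularParametrizationData)
    (h163 : PastenShimura2024_minimalDegree_le_163_mul)
    (hd : ∀ (W₀ : WeierstrassCurve ℚ) [W₀.IsElliptic] (N : ℕ) [NeZero N] (D₀ : ModularParametrizationData W₀ N),
      (∀ (W' : WeierstrassCurve ℚ) [W'.IsElliptic] (D' : ModularParametrizationData W' N),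
          D'.f = D₀.f → D₀.modularDegree ≤ D'.modularDegree) →
        D₀.modularDegree ∣ anemicCongruenceNumber D₀.f)
    (h : MurtyPastenConj44 K C) : PolyModularDegreeRat K := by
  refine ⟨163 * Real.exp C, polyModularDegreeRatEff_of_optimal_bound hmod h163 fun W₀ _ N _ D₀ hopt => ?_⟩
  obtain ⟨hpos, hlog⟩ := h W₀ N D₀
  have hle : (D₀.modularDegree : ℝ) ≤ (anemicCongruenceNumber D₀.f : ℝ) := by
    exact_mod_cast Nat.le_of_dvd hpos (hd W₀ N D₀ hopt)
  have hN : (0 : ℝ) < N := by exact_mod_cast Nat.pos_of_ne_zero (NeZero.ne N)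
  have ha : (0 : ℝ) < anemicCongruenceNumber D₀.f := by exact_mod_cast hpos
  exact hle.trans (le_exp_mul_rpow_of_log_le ha hN hlog)

/-- **Converse (height ⇒ degree): `PolyFaltingsHeightRat K ∧ PolyManinRat μ ∧ PeterssonUpperRat θ ⇒ PolyModularDegreeRat (2K + 2μ + 1 + θ)`** — Zagier read
backwards, `log deg = 2h + log(4π² c² (f,f))`: the Manin constant and the Petersson UPPER bound are exactly the inputs of this direction (Frey 1989; Mai–Murty
1994; Murty 1999 Thm 1 (ii); Pasten 2024 Rem. 3.3), modulo modularity (existence of a datum). [cite: MaiMurty1994] [cite: PastenShimura2024, Rem. 3.3] -/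
theorem polyModularDegreeRat_of_polyFaltingsHeightRat_of_manin_of_petersson {K μ θ : ℝ}
    (hmod : nonempty_modularParametrizationData) (hh : PolyFaltingsHeightRat K) (hM : PolyManinRat μ)
    (hU : PeterssonUpperRat θ) : PolyModularDegreeRat (2 * K + 2 * μ + 1 + θ) := by
  obtain ⟨Ch, hh⟩ := hh
  obtain ⟨M, hM⟩ := hM
  obtain ⟨P, hU⟩ := hU
  refine ⟨Real.exp (2 * Ch) * (4 * Real.pi ^ 2 * M ^ 2 * P), fun W _ _ _ => ?_⟩
  obtain ⟨D, hc⟩ := hM W (hmod W)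
  refine ⟨D, ?_⟩
  set Nr : ℝ := (W.conductorNorm ℤ : ℝ) with hNr
  have hN : (0 : ℝ) < Nr := by rw [hNr]; exact_mod_cast conductorNorm_pos_holds W
  have hz := D.two_mul_faltingsHeight_eq
  have hP := hU _ W D.f D.isNewformOf
  have hp0 : 0 < (peterssonProduct (Gamma0 (W.conductorNorm ℤ)) 2 D.f D.f).re :=
    lt_of_lt_of_le (by positivity) D.isNewformOf.exp_div_le_peterssonProduct
  have hc0 : (D.maninConstant : ℝ) ≠ 0 := by exact_mod_cast D.maninConstant_ne_zero_holds
  have hdeg : (0 : ℝ) < D.modularDegree := by exact_mod_cast D.deg_pos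
  -- `deg = e^{2h} · 4π² c² (f,f)` (Zagier), then bound each factor
  have hprod : 0 < 4 * Real.pi ^ 2 * (D.maninConstant : ℝ) ^ 2 *
      (peterssonProduct (Gamma0 (W.conductorNorm ℤ)) 2 D.f D.f).re := by positivity
  have hdegeq : (D.modularDegree : ℝ) = Real.exp (2 * W.faltingsHeight) *
      (4 * Real.pi ^ 2 * (D.maninConstant : ℝ) ^ 2 *
        (peterssonProduct (Gamma0 (W.conductorNorm ℤ)) 2 D.f D.f).re) := by
    rw [hz, Real.exp_sub, Real.exp_log hdeg, Real.exp_log hprod, div_mul_cancel₀ _ hprod.ne']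
  have hexp : Real.exp (2 * W.faltingsHeight) ≤ Real.exp (2 * Ch) * Nr ^ (2 * K) := by
    have h1 := hh W
    calc Real.exp (2 * W.faltingsHeight) ≤ Real.exp (2 * (K * Real.log Nr + Ch)) :=
          Real.exp_le_exp.mpr (by linarith)
      _ = Real.exp (2 * Ch) * Nr ^ (2 * K) := by
          rw [show 2 * (K * Real.log Nr + Ch) = 2 * Ch + Real.log Nr * (2 * K) by ring, Real.exp_add,
            Real.rpow_def_of_pos hN]
  have hcsq : (D.maninConstant : ℝ) ^ 2 ≤ M ^ 2 * Nr ^ (2 * μ) := by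
    have habs : |(D.maninConstant : ℝ)| ≤ M * Nr ^ μ := hc
    have h0 : 0 ≤ |(D.maninConstant : ℝ)| := abs_nonneg _
    have hsq : (Nr ^ μ) ^ 2 = Nr ^ (2 * μ) := by
      rw [show (2 : ℝ) * μ = μ * 2 by ring, Real.rpow_mul hN.le, Real.rpow_two]
    calc (D.maninConstant : ℝ) ^ 2 = |(D.maninConstant : ℝ)| ^ 2 := (sq_abs _).symm
      _ ≤ (M * Nr ^ μ) ^ 2 := pow_le_pow_left₀ h0 habs 2
      _ = M ^ 2 * Nr ^ (2 * μ) := by rw [mul_pow, hsq]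
  have hNK : 0 ≤ Nr ^ (2 * K) := (Real.rpow_pos_of_pos hN _).le
  have hNμ : 0 ≤ Nr ^ (2 * μ) := (Real.rpow_pos_of_pos hN _).le
  have hNθ : 0 ≤ Nr ^ (1 + θ) := (Real.rpow_pos_of_pos hN _).le
  have hM0 : 0 ≤ M ^ 2 := sq_nonneg _
  have hP0 : 0 ≤ P := by
    by_contra hP0
    have : P * Nr ^ (1 + θ) ≤ 0 := mul_nonpos_of_nonpos_of_nonneg (not_le.mp hP0).le hNθ
    linarith
  calc (D.modularDegree : ℝ)
      = Real.exp (2 * W.faltingsHeight) * (4 * Real.pi ^ 2 * (D.maninConstant : ℝ) ^ 2 *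
          (peterssonProduct (Gamma0 (W.conductorNorm ℤ)) 2 D.f D.f).re) := hdegeq
    _ ≤ (Real.exp (2 * Ch) * Nr ^ (2 * K)) * (4 * Real.pi ^ 2 * (M ^ 2 * Nr ^ (2 * μ)) * (P * Nr ^ (1 + θ))) := by
        gcongr
    _ = Real.exp (2 * Ch) * (4 * Real.pi ^ 2 * M ^ 2 * P) * (Nr ^ (2 * K) * Nr ^ (2 * μ) * Nr ^ (1 + θ)) := by
        ring
    _ = Real.exp (2 * Ch) * (4 * Real.pi ^ 2 * M ^ 2 * P) * Nr ^ (2 * K + 2 * μ + 1 + θ) := by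
        rw [← Real.rpow_add hN, ← Real.rpow_add hN]; ring_nf

/-! ## §4 A0 skeletons: the SHARP rows + Hoffstein–Lockhart give `ABC` and Szpiro `6+ε` -/

/-- The sharp degree row restricted to semistable curves and padded with the Manin constant (`c² ≥ 1`): the shape
consumed by the tree's `abcLe_of_semistableDegreeBound`. [folklore] -/
theorem semistableDegreeBound_cSq_of_degreeConjectureRat (h : DegreeConjectureRat) :
    ∀ ε : ℝ, 0 < ε → ∃ C : ℝ, ∀ (W : WeierstrassCurve ℚ) [W.IsElliptic] [W.IsGloballyMinimal]
      [NeZero (W.conductorNorm ℤ)], W.IsSemistable ℤ → ∃ D : ModularParametrizationData W (W.conductorNorm ℤ),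
        (D.deg : ℝ) ≤ C * (D.c : ℝ) ^ 2 * ((W.conductorNorm ℤ : ℕ) : ℝ) ^ (2 + ε) := by
  intro ε hε
  obtain ⟨C, hC⟩ := h ε hε
  refine ⟨max C 0, fun W _ _ _ _ => ?_⟩
  obtain ⟨D, hD⟩ := hC W
  refine ⟨D, ?_⟩
  have hc1 : (1 : ℝ) ≤ (D.c : ℝ) ^ 2 := by
    have h0 : D.c ≠ 0 := D.maninConstant_ne_zero_holds
    have h1 : (1 : ℤ) ≤ D.c ^ 2 := by nlinarith [Int.one_le_abs h0, sq_abs D.c]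
    exact_mod_cast h1
  have hNκ : (0 : ℝ) ≤ ((W.conductorNorm ℤ : ℕ) : ℝ) ^ (2 + ε) := by positivity
  calc (D.deg : ℝ) = (D.modularDegree : ℝ) := rfl
    _ ≤ C * ((W.conductorNorm ℤ : ℕ) : ℝ) ^ (2 + ε) := hD
    _ ≤ max C 0 * ((W.conductorNorm ℤ : ℕ) : ℝ) ^ (2 + ε) := by gcongr; exact le_max_left _ _
    _ = max C 0 * 1 * ((W.conductorNorm ℤ : ℕ) : ℝ) ^ (2 + ε) := by ring
    _ ≤ max C 0 * (D.c : ℝ) ^ 2 * ((W.conductorNorm ℤ : ℕ) : ℝ) ^ (2 + ε) := by gcongr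

/-- **S4 (A0): the sharp degree conjecture for all `E/ℚ` + the Petersson `1−ε` NAMED FACT (Hoffstein–Lockhart 1994) ⇒ the summit statement `ABC`** — Murty
1999 Thm 1 (i) / Frey 1989, through the tree's `abcLe_of_semistableDegreeBound` (Silverman's covolume inequality PROVED) and `abcLt_of_abcLe`. abc is NOT
proved: `DegreeConjectureRat` is an open, abc-equivalent hypothesis. [cite: MurtyCongruencePrimes1999, Thm. 1 (i)] -/
theorem abc_of_degreeConjectureRat (hP : murty_petersson_newform_lower_bound) (h : DegreeConjectureRat) :
    ABC :=
  abcLt_of_abcLe (abcLe_of_semistableDegreeBound hP silverman1986_discriminant_c4_covolume_holds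
    (semistableDegreeBound_cSq_of_degreeConjectureRat h))

/-- **S4′ (A0): the same two hypotheses give Szpiro `6+ε` for ALL `E/ℚ`** (`SzpiroConjecture`), through abc
(`szpiro_of_abcLe_holds`, PROVED): the Frey loss map `2+ε ↦ 1+ε ↦ 6+ε`. [cite: MurtyCongruencePrimes1999, Thm. 1 (i)] -/
theorem szpiro_of_degreeConjectureRat (hP : murty_petersson_newform_lower_bound) (h : DegreeConjectureRat) :
    SzpiroConjecture :=
  szpiro_of_abcLe_holds (abcLe_of_semistableDegreeBound hP silverman1986_discriminant_c4_covolume_holds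
    (semistableDegreeBound_cSq_of_degreeConjectureRat h))

/-- **R4♯ ⇒ R1♯ on semistable curves, hence `ABC`** (mod Ribet, modularity, Mazur–Kenku, HL): semistable ⇒ square-free
conductor (`isSemistable_iff_squarefree_conductorNorm`, PROVED) ⇒ R4♯ bounds `r_f ≥ m_f`, hence (`× 163`) a datum of `W`.
abc is NOT proved: R4♯ is an abc-strength hypothesis. [cite: MurtyCongruencePrimes1999, Thm. 1] [cite: AgasheRibetStein2012, Thm. 2.1] -/
theorem abc_of_sharpCongruenceNumberRat (hmod : nonempty_modularParametrizationData)
    (hR : modularDegree_dvd_congruenceNumber) (h163 : PastenShimura2024_minimalDegree_le_163_mul)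
    (hP : murty_petersson_newform_lower_bound) (h : SharpCongruenceNumberRat) : ABC := by
  refine abcLt_of_abcLe (abcLe_of_semistableDegreeBound hP silverman1986_discriminant_c4_covolume_holds
    fun ε hε => ?_)
  obtain ⟨C, hC⟩ := h ε hε
  refine ⟨163 * max C 0, fun W _ _ _ hss => ?_⟩
  have hsq : Squarefree (W.conductorNorm ℤ) := (isSemistable_iff_squarefree_conductorNorm W).mp hss
  obtain ⟨DW, -, hDW⟩ := exists_minimal_datum (hmod W)
  obtain ⟨W₀, _, D₀, hf, hopt⟩ := Pasten2024.exists_minimal_datum_in_class DW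
  have h163' : DW.modularDegree ≤ 163 * D₀.modularDegree := h163 _ W₀ W D₀ DW hf.symm hopt hDW
  have hle : D₀.modularDegree ≤ congruenceNumber D₀.f :=
    Nat.le_of_dvd (congruenceNumber_pos_of_datum D₀) (hR W₀ _ D₀ hopt)
  have h1 : (DW.modularDegree : ℝ) ≤ 163 * (D₀.modularDegree : ℝ) := by exact_mod_cast h163'
  have h2 : (D₀.modularDegree : ℝ) ≤ (congruenceNumber D₀.f : ℝ) := by exact_mod_cast hle
  have h3 := hC W₀ _ D₀ hsq
  have hc1 : (1 : ℝ) ≤ (DW.c : ℝ) ^ 2 := by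
    have h0 : DW.c ≠ 0 := DW.maninConstant_ne_zero_holds
    have h1 : (1 : ℤ) ≤ DW.c ^ 2 := by nlinarith [Int.one_le_abs h0, sq_abs DW.c]
    exact_mod_cast h1
  have hNκ : (0 : ℝ) ≤ ((W.conductorNorm ℤ : ℕ) : ℝ) ^ (2 + ε) := by positivity
  refine ⟨DW, ?_⟩
  calc (DW.deg : ℝ) = (DW.modularDegree : ℝ) := rfl
    _ ≤ 163 * (C * ((W.conductorNorm ℤ : ℕ) : ℝ) ^ (2 + ε)) := by linarith
    _ ≤ 163 * (max C 0 * ((W.conductorNorm ℤ : ℕ) : ℝ) ^ (2 + ε)) := by gcongr; exact le_max_left _ _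
    _ = 163 * max C 0 * 1 * ((W.conductorNorm ℤ : ℕ) : ℝ) ^ (2 + ε) := by ring
    _ ≤ 163 * max C 0 * (DW.c : ℝ) ^ 2 * ((W.conductorNorm ℤ : ℕ) : ℝ) ^ (2 + ε) := by gcongr

/-! ## §5 Floor for R4 -/
/-- **R4 floor: `PolyCongruenceNumberRat K` is FALSE for `K < 3/2`** modulo modularity, Ribet and Mazur–Kenku (S3, then file I's unconditional
`not_polyModularDegreeRat_of_lt_three_halves`: Masser + Iwaniec). [cite: Masser1990, Theorem] -/
theorem not_polyCongruenceNumberRat_of_lt_three_halves (hmod : nonempty_modularParametrizationData)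
    (hR : modularDegree_dvd_congruenceNumber) (h163 : PastenShimura2024_minimalDegree_le_163_mul)
    {K : ℝ} (hK : K < 3 / 2) : ¬ PolyCongruenceNumberRat K :=
  fun h => not_polyModularDegreeRat_of_lt_three_halves hK
    (polyModularDegreeRat_of_polyCongruenceNumberRat hmod hR h163 h)

/-! ## §6 The table's conclusions BY NAME against the sub-summit Prop `Summit.ABC.PolySzpiroRat` (rung A-PS)

The obligation-graph edges GAP row → A-PS. «NOT abc; first polynomial bound would supersede Stewart–Yu's exponential». -/
/-- **R1 ⇒ A-PS by name** (S1 of file I): `PolyModularDegreeRat K → Summit.ABC.PolySzpiroRat`, NO other hypothesis. [cite: PastenShimura2024, §3 (3.1)–(3.2)] -/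
theorem polySzpiroRat_of_polyModularDegreeRat {K : ℝ} (h : PolyModularDegreeRat K) : Summit.ABC.PolySzpiroRat :=
  polySzpiroRat_of_polyModularDegree h

/-- **R1 ⇒ A-PS-eff by name**, exponent `6K`, constant `6 log C + 24π + 16`. [cite: PastenShimura2024, §3 (3.1)–(3.2)] -/
theorem polySzpiroRatEff_of_polyModularDegreeRatEff' {K C : ℝ} (h : PolyModularDegreeRatEff K C) :
    Summit.ABC.PolySzpiroRatEff (6 * K) (6 * Real.log C + 24 * Real.pi + 16) :=
  fun W _ => polySzpiroRatEff_of_polyModularDegreeRatEff h W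

/-- **R1 ⇒ A-PS-eff by name, sharp exponent `6K − 3 + ε`** (hypothesis-free; S1♯ of file I). [cite: Iwaniec2002, Thm. 8.3] [cite: PastenShimura2024, §3] -/
theorem exists_polySzpiroRatEff_sharp_of_polyModularDegreeRat {K ε : ℝ} (hε : 0 < ε)
    (h : PolyModularDegreeRat K) : ∃ C' : ℝ, Summit.ABC.PolySzpiroRatEff (6 * K - 3 + ε) C' :=
  polySzpiroRat_of_polyModularDegreeRat_sharp hε h

/-- **R5 ⇒ A-PS by name** (S2 of file I): `PolyFaltingsHeightRat K → Summit.ABC.PolySzpiroRat`, NO other hypothesis. [cite: PastenShimura2024, Lemma 18.1] -/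
theorem polySzpiroRat_of_polyFaltingsHeightRat {K : ℝ} (h : PolyFaltingsHeightRat K) : Summit.ABC.PolySzpiroRat :=
  polySzpiroRat_of_polyFaltingsHeight h

/-- **R5 ⇒ A-PS-eff by name**, exponent `12K`, constant `12C + 16`. [cite: PastenShimura2024, Lemma 18.1] -/
theorem polySzpiroRatEff_of_polyFaltingsHeightRatEff' {K C : ℝ} (h : PolyFaltingsHeightRatEff K C) :
    Summit.ABC.PolySzpiroRatEff (12 * K) (12 * C + 16) :=
  fun W _ => polySzpiroRatEff_of_polyFaltingsHeightRatEff h W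

/-- **R4 ⇒ A-PS by name** (S3 + S1), modulo modularity, Ribet, Mazur–Kenku. [cite: AgasheRibetStein2012, Thm. 2.1] -/
theorem polySzpiroRat_of_polyCongruenceNumberRat {K : ℝ} (hmod : nonempty_modularParametrizationData)
    (hR : modularDegree_dvd_congruenceNumber) (h163 : PastenShimura2024_minimalDegree_le_163_mul)
    (h : PolyCongruenceNumberRat K) : Summit.ABC.PolySzpiroRat :=
  polySzpiroRat_of_polyModularDegree (polyModularDegreeRat_of_polyCongruenceNumberRat hmod hR h163 h)

/-- **R9 ⇒ A-PS by name** (S3′ + S1; MP 2013 Thm 4.5 in kernel form), modulo modularity, Mazur–Kenku and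
`m_f ∣ n'_f`. [cite: MurtyPasten2013, Thm. 4.5 (p. 3748)] -/
theorem polySzpiroRat_of_murtyPastenConj44 {K C : ℝ} (hmod : nonempty_modularParametrizationData)
    (h163 : PastenShimura2024_minimalDegree_le_163_mul)
    (hd : ∀ (W₀ : WeierstrassCurve ℚ) [W₀.IsElliptic] (N : ℕ) [NeZero N] (D₀ : ModularParametrizationData W₀ N),
      (∀ (W' : WeierstrassCurve ℚ) [W'.IsElliptic] (D' : ModularParametrizationData W' N),
          D'.f = D₀.f → D₀.modularDegree ≤ D'.modularDegree) →
        D₀.modularDegree ∣ anemicCongruenceNumber D₀.f)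
    (h : MurtyPastenConj44 K C) : Summit.ABC.PolySzpiroRat :=
  polySzpiroRat_of_polyModularDegree (polyModularDegreeRat_of_murtyPastenConj44 hmod h163 hd h)

/-- **A-PS floor by name**: `Summit.ABC.PolySzpiroRatEff K C` is FALSE for `K ≤ 6` (Masser 1990; file I). [cite: Masser1990, Theorem] -/
theorem not_polySzpiroRatEff_of_le_six {K C : ℝ} (hK : K ≤ 6) : ¬ Summit.ABC.PolySzpiroRatEff K C :=
  not_polySzpiroLog_of_le_six hK

/-- **Currency bridge by name**: `Summit.ABC.PolySzpiroRat` (log form, LADDER-ABC §1) ↔ the multiplicative form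
`∃ K C, ∀ E, |Δ_min| ≤ C · N ^ K` (binder shape of `SzpiroConjecture` with a free exponent). [folklore] -/
theorem polySzpiroRat_iff_rpow :
    Summit.ABC.PolySzpiroRat ↔ ∃ K C : ℝ, ∀ (W : WeierstrassCurve ℚ) [W.IsElliptic],
      (W.minimalDiscriminantNorm ℤ : ℝ) ≤ C * (W.conductorNorm ℤ : ℝ) ^ K := by
  constructor
  · rintro ⟨K, C, h⟩
    refine ⟨K, Real.exp C, fun W _ => ?_⟩
    have hN : (0 : ℝ) < (W.conductorNorm ℤ : ℝ) := by exact_mod_cast conductorNorm_pos_holds W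
    have hΔ : (0 : ℝ) < (W.minimalDiscriminantNorm ℤ : ℝ) := by
      exact_mod_cast minimalDiscriminantNorm_pos_holds W
    exact le_exp_mul_rpow_of_log_le hΔ hN (h W)
  · rintro ⟨K, C, h⟩
    refine ⟨K, Real.log C, fun W _ => ?_⟩
    have hN : (0 : ℝ) < (W.conductorNorm ℤ : ℝ) := by exact_mod_cast conductorNorm_pos_holds W
    have hΔ : (1 : ℝ) ≤ (W.minimalDiscriminantNorm ℤ : ℝ) := by
      exact_mod_cast minimalDiscriminantNorm_pos_holds W
    have hW := h W
    have hNK : (0 : ℝ) < (W.conductorNorm ℤ : ℝ) ^ K := Real.rpow_pos_of_pos hN K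
    have hCpos : 0 < C := by
      by_contra hC0
      have : C * (W.conductorNorm ℤ : ℝ) ^ K ≤ 0 := mul_nonpos_of_nonpos_of_nonneg (not_lt.mp hC0) hNK.le
      linarith
    have := Real.log_le_log (by linarith) hW
    rw [Real.log_mul hCpos.ne' hNK.ne', Real.log_rpow hN] at this
    linarith

end Summit.ABC.Analytic
end
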